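import Literature.NumberTheory.ComplexMultiplication.CMTypeRankMultiplicityOne
import Literature.AlgebraicGeometry.Pohlmann1968.SeparatingCMFamilies
import HarnessLib

/-!
# CM fields whose conjugate pairs of embeddings are flipped one at a time by `Aut(ℂ)`: every CM type is nondegenerate,
# and a family of types of the field is nondegenerate iff its type vectors are linearly independent

COR-CM (cell `pub-hodgecm2`), seat p2 gen 21; count-neutral; theorems only, no definition, no named fact, no `sorry`.
The CM-field dress of `Literature/NumberTheory/ComplexMultiplication/CMTypeRankEvaluationCriterion` /
`CMTypeRankSameSlotFamilies` / `CMTypeRankMultiplicityOne` (the non-abelian Kubota criterion and its same-slot form).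

SETTING.  `K` a CM field, `X = Hom(K, ℂ)` with its `Aut(ℂ)`-action `τ • s = τ ∘ s` and complex conjugation `ρ`
(`ρ • s = s̄`).  The PAIR-FLIP hypothesis

  `∀ s, ∃ σ ∈ Aut(ℂ), σ • s = s̄ ∧ ∀ t ∉ {s, s̄}, σ • t = t`

says that the image of `Aut(ℂ)` in the permutations of the `n` conjugate pairs of embeddings contains all `2^n` sign
changes — the GENERIC case `[K^{gal} : ℚ] = 2^n · [F^{gal} : ℚ]` for `K = F(√−δ)` (for `[K:ℚ] = 6`: Galois closure of
degree 24 or 48, equivalently no imaginary quadratic subfield).  Then: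

* §1 `exists_smul_sub_of_pairFlip` — MULTIPLICITY ONE of the odd weights: every `Aut(ℂ)`-equivariant linear map
  `ℚ^X → ℚ^X` with `ρ`-odd values is a scalar multiple of `f ↦ f − f∘ρ` (an equivariant `T` sends `δ_s` to a vector fixed
  by every flip `σ_t`, `t ∉ {s, s̄}`, and odd, hence supported on `{s, s̄}`; transitivity of `Aut(ℂ)` makes the scalar
  independent of `s`);
* §2 `isNondegenerate_of_pairFlip` — EVERY CM type of `K` is nondegenerate (so primitive: every CM abelian variety
  with CM by `K` is simple and has `B• = D•` on all its powers); `isSimple_of_pairFlip`;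
* §3 `isNondegenerateFamily_iff_linearIndependent_of_pairFlip` — a family `(Φ_i)_i` of CM types of `K` is nondegenerate
  (`Hg(∏ A_{Φ_i}) = ∏ Hg(A_{Φ_i})`, `B• = D•` on all products) **iff the type vectors `u_{Φ_i} = 𝟙_{Φ_i} − 𝟙_{Φ̄_i} ∈
  ℚ^X` are linearly independent**; and, for ANY CM field (no hypothesis), `card_le_finrank_div_two_of_isNondegenerateFamily`:
  a nondegenerate family of CM types of ONE field `K` has at most `[K:ℚ]/2` members.

Sequel (`CorCM/GenericCMFieldSameFieldFamiliesHodge`): pairs and triples of pairwise inequivalent types are independent,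
four types of a sextic field never are — the Hodge conjecture on the corresponding products and the exceptional classes.
-/

noncomputable section

open CategoryTheory NumberField

namespace Summit.HodgeConjecture.CorCM.GenericCMField

open Literature.NumberTheory.ComplexMultiplication
open Literature.AlgebraicGeometry.Motives (AbelianVariety CMType)
open Literature.AlgebraicGeometry.HodgeTheory (complexBetti)
open Literature.AlgebraicGeometry.ComplexMultiplication (IsCMTypeRealisation isSimple_iff_isPrimitive)
open Literature.AlgebraicGeometry.Pohlmann1968

variable {K : Type} [Field K] [NumberField K] [IsCMField K]

/-! ## §1 Multiplicity one of the odd weights from pair flips -/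

section MultiplicityOne

open scoped Classical

/-- Complex conjugation commutes with every automorphism of `ℂ` on the embeddings of a CM field. -/
theorem smul_conj_smul (g : ℂ ≃+* ℂ) (s : K →+* ℂ) :
    g • (starRingAut : ℂ ≃+* ℂ) • s = (starRingAut : ℂ ≃+* ℂ) • g • s := by
  refine RingHom.ext fun x => ?_
  change g (starRingEnd ℂ (s x)) = starRingEnd ℂ (g (s x))
  rw [← IsCMField.complexEmbedding_complexConj K s x]
  exact IsCMField.complexEmbedding_complexConj K ((g : ℂ →+* ℂ).comp s) x

omit [NumberField K] [IsCMField K] in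
/-- `ρ • ρ • s = s` on embeddings. -/
theorem conj_smul_conj_smul (s : K →+* ℂ) :
    (starRingAut : ℂ ≃+* ℂ) • (starRingAut : ℂ ≃+* ℂ) • s = s := by
  rw [conj_smul_eq_conjugate, conj_smul_eq_conjugate]
  exact ComplexEmbedding.involutive_conjugate K s

omit [NumberField K] [IsCMField K] in
/-- The translate of a point mass: `x ↦ δ_s(g⁻¹x)` is `δ_{g s}`. -/
theorem ite_inv_smul_eq (g : ℂ ≃+* ℂ) (s : K →+* ℂ) (c : ℚ) :
    (fun x : K →+* ℂ => if s = g⁻¹ • x then c else 0) = fun x => if g • s = x then c else 0 := by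
  funext x
  rw [eq_inv_smul_iff]

/-- **Pair flips ⟹ multiplicity one of the odd weights.**  If every conjugate pair `{s, s̄}` of embeddings of the CM
field `K` is flipped by an automorphism of `ℂ` fixing all other embeddings, then every `Aut(ℂ)`-equivariant linear map
`T : ℚ^{Hom(K,ℂ)} → ℚ^{Hom(K,ℂ)}` with conjugation-odd values is a scalar multiple of `f ↦ f − f∘ρ`. -/
theorem exists_smul_sub_of_pairFlip
    (hflip : ∀ s : K →+* ℂ, ∃ σ : ℂ ≃+* ℂ, σ • s = (starRingAut : ℂ ≃+* ℂ) • s ∧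
      ∀ t : K →+* ℂ, t ≠ s → t ≠ (starRingAut : ℂ ≃+* ℂ) • s → σ • t = t)
    (T : ((K →+* ℂ) → ℚ) →ₗ[ℚ] ((K →+* ℂ) → ℚ))
    (hT : ∀ (g : ℂ ≃+* ℂ) (f : (K →+* ℂ) → ℚ), T (fun x => f (g⁻¹ • x)) = fun x => T f (g⁻¹ • x))
    (hodd : ∀ (f : (K →+* ℂ) → ℚ) (x : K →+* ℂ), T f ((starRingAut : ℂ ≃+* ℂ) • x) = -T f x) :
    ∃ c : ℚ, ∀ f, T f = c • fun x => f x - f ((starRingAut : ℂ ≃+* ℂ) • x) := by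
  set ρ : ℂ ≃+* ℂ := starRingAut with hρ
  -- point masses and their images
  let δ : (K →+* ℂ) → (K →+* ℂ) → ℚ := fun s x => if s = x then 1 else 0
  have hδg : ∀ (g : ℂ ≃+* ℂ) (s : K →+* ℂ), (fun x => δ s (g⁻¹ • x)) = δ (g • s) := fun g s =>
    ite_inv_smul_eq g s 1
  -- `a_s = T δ_s` vanishes off `{s, s̄}`
  have hoff : ∀ s t : K →+* ℂ, t ≠ s → t ≠ ρ • s → T (δ s) t = 0 := by
    intro s t hts htc
    obtain ⟨σ, hσs, hσt⟩ := hflip t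
    -- `σ` fixes `s` (as `s ∉ {t, t̄}`), hence `T δ_s` is `σ`-invariant
    have hσfix : σ • s = s := by
      refine hσt s (Ne.symm hts) fun h => htc ?_
      rw [h, conj_smul_conj_smul]
    have h1 := hT σ (δ s)
    rw [hδg, hσfix] at h1
    -- evaluate at `σ • t = t̄`
    have h2 := congrFun h1 (σ • t)
    simp only [inv_smul_smul] at h2
    rw [hσs, hodd] at h2
    linarith
  -- hence `a_s = a_s(s) (δ_s − δ_{s̄})`
  have hsne : ∀ s : K →+* ℂ, s ≠ ρ • s := fun s h => by
    rw [hρ, conj_smul_eq_conjugate] at h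
    exact IsTotallyComplex.complexEmbedding_not_isReal s (ComplexEmbedding.isReal_iff.2 h.symm)
  have hshape : ∀ s x : K →+* ℂ, T (δ s) x = T (δ s) s * (δ s x - δ s (ρ • x)) := by
    intro s x
    by_cases hxs : x = s
    · subst hxs
      simp only [δ, if_pos rfl, if_neg (hsne x)]
      ring
    · by_cases hxc : x = ρ • s
      · subst hxc
        rw [hodd, conj_smul_conj_smul]
        simp only [δ, if_pos rfl, if_neg (hsne s)]
        ring
      · have hsx : s ≠ ρ • x := fun h => hxc (by rw [h, conj_smul_conj_smul])
        rw [hoff s x hxs hxc]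
        simp only [δ, if_neg (Ne.symm hxs), if_neg hsx]
        ring
  -- the scalar `a_s(s)` does not depend on `s` (transitivity of `Aut(ℂ)`)
  haveI := isPretransitive_ringEquiv_complex (K := K)
  obtain ⟨s₀⟩ : Nonempty (K →+* ℂ) := inferInstance
  have hconst : ∀ s : K →+* ℂ, T (δ s) s = T (δ s₀) s₀ := by
    intro s
    obtain ⟨g, hg⟩ := MulAction.exists_smul_eq (ℂ ≃+* ℂ) s₀ s
    have h1 := hT g (δ s₀)
    rw [hδg, hg] at h1
    rw [congrFun h1 s, ← hg, inv_smul_smul]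
  refine ⟨T (δ s₀) s₀, fun f => ?_⟩
  -- expand `f = Σ_s f(s) δ_s`
  have hf : f = ∑ s, f s • δ s := by
    convert pi_eq_sum_univ f using 1
  have hsum1 : ∀ y : K →+* ℂ, ∑ s, f s * δ s y = f y := fun y => by
    simp only [δ, mul_ite, mul_one, mul_zero, Finset.sum_ite_eq', Finset.mem_univ, if_true]
  conv_lhs => rw [hf]
  rw [map_sum]
  funext x
  simp only [map_smul, Finset.sum_apply, Pi.smul_apply, smul_eq_mul]
  rw [Finset.sum_congr rfl fun s _ => show f s * T (δ s) x = T (δ s₀) s₀ * (f s * δ s x - f s * δ s (ρ • x)) by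
      rw [hshape s x, hconst s]; ring,
    ← Finset.mul_sum, Finset.sum_sub_distrib, hsum1, hsum1]

end MultiplicityOne

/-! ## §2 Every CM type of a pair-flip field is nondegenerate -/

section Types

/-- **Every CM type of a pair-flip CM field is nondegenerate** (`rank(Φ) = [K:ℚ]/2 + 1`: the translates of `u_Φ` span
the odd weights, an irreducible `Aut(ℂ)`-module occurring once in `ℚ^{Hom(K,ℂ)}`). -/
theorem isNondegenerate_of_pairFlip
    (hflip : ∀ s : K →+* ℂ, ∃ σ : ℂ ≃+* ℂ, σ • s = (starRingAut : ℂ ≃+* ℂ) • s ∧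
      ∀ t : K →+* ℂ, t ≠ s → t ≠ (starRingAut : ℂ ≃+* ℂ) • s → σ • t = t)
    (Φ : CMType K) : IsNondegenerate Φ := by
  rw [isNondegenerate_iff, cmTypeRank, ← Embeddings.card K ℂ]
  exact typeRank_eq_of_multiplicityOne (isCMTypeWith_conj Φ) (exists_smul_sub_of_pairFlip hflip)

/-- **Every CM type of a pair-flip CM field is primitive** (Kubota: nondegenerate ⟹ primitive). -/
theorem isPrimitive_of_pairFlip
    (hflip : ∀ s : K →+* ℂ, ∃ σ : ℂ ≃+* ℂ, σ • s = (starRingAut : ℂ ≃+* ℂ) • s ∧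
      ∀ t : K →+* ℂ, t ≠ s → t ≠ (starRingAut : ℂ ≃+* ℂ) • s → σ • t = t)
    (Φ : CMType K) (s₀ : K →+* ℂ) : IsPrimitive (ℂ ≃+* ℂ) Φ.1 s₀ :=
  (isNondegenerate_of_pairFlip hflip Φ).isPrimitive s₀

/-- **Every CM abelian variety with CM by a pair-flip CM field is simple** (Shimura §8.2 Prop. 26). -/
theorem isSimple_of_pairFlip
    (hflip : ∀ s : K →+* ℂ, ∃ σ : ℂ ≃+* ℂ, σ • s = (starRingAut : ℂ ≃+* ℂ) • s ∧
      ∀ t : K →+* ℂ, t ≠ s → t ≠ (starRingAut : ℂ ≃+* ℂ) • s → σ • t = t)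
    {Φ : CMType K} {A : AbelianVariety ℂ} {ι : 𝓞 K →+* End A} {θ : K →+* Module.End ℂ (complexBetti A.X 1)}
    (hA : IsCMTypeRealisation Φ A ι θ) : A.IsSimple := by
  obtain ⟨s₀⟩ : Nonempty (K →+* ℂ) := inferInstance
  exact (isSimple_iff_isPrimitive hA s₀).2 (isPrimitive_of_pairFlip hflip Φ s₀)

end Types

/-! ## §3 Families of types of one field: nondegenerate ⟺ independent type vectors; at most `n` members -/

section Families

variable {I : Type} [Fintype I] [DecidableEq I] [Nonempty I]

omit [NumberField K] [IsCMField K] [Fintype I] [DecidableEq I] [Nonempty I] in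
/-- The rank of a family of types of ONE field is the abstract rank of the same-slot family type (definitionally). -/
theorem cmFamilyRank_eq_typeRank_sigmaType (Φ : I → CMType K) :
    CMAlgebra.cmFamilyRank (K := fun _ : I => K) Φ =
      typeRank (ℂ ≃+* ℂ) (sigmaType (E := fun _ : I => K →+* ℂ) fun i => (Φ i).1) :=
  rfl

omit [IsCMField K] [DecidableEq I] [Nonempty I] in
/-- `IsNondegenerateFamily` for types of one field, in the abstract same-slot form. -/
theorem isNondegenerateFamily_iff_typeRank_sigmaType_eq (Φ : I → CMType K) :
    CMAlgebra.IsNondegenerateFamily (K := fun _ : I => K) Φ ↔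
      typeRank (ℂ ≃+* ℂ) (sigmaType (E := fun _ : I => K →+* ℂ) fun i => (Φ i).1) =
        Fintype.card (Σ _ : I, K →+* ℂ) / 2 + 1 := by
  rw [CMAlgebra.isNondegenerateFamily_iff, cmFamilyRank_eq_typeRank_sigmaType, Fintype.card_sigma,
    Finset.sum_congr rfl fun i _ => Embeddings.card K ℂ]

omit [DecidableEq I] in
/-- **A nondegenerate family of CM types of ONE CM field `K` has at most `[K:ℚ]/2` members** (any CM field, no
hypothesis: the type vectors of a nondegenerate same-field family are linearly independent odd weights).  In
particular at most `[K:ℚ]/2` pairwise non-isogenous CM abelian varieties with CM by `K` can have `Hg(∏ A_i) = ∏ Hg(A_i)`. -/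
theorem card_le_finrank_div_two_of_isNondegenerateFamily (Φ : I → CMType K)
    (hΦ : CMAlgebra.IsNondegenerateFamily (K := fun _ : I => K) Φ) : Fintype.card I ≤ Module.finrank ℚ K / 2 := by
  classical
  rw [isNondegenerateFamily_iff_typeRank_sigmaType_eq] at hΦ
  rw [← Embeddings.card K ℂ]
  exact card_le_card_div_two_of_typeRank_sigmaType_eq (fun i => (Φ i).1) (fun i => isCMTypeWith_conj (Φ i)) hΦ

omit [DecidableEq I] in
/-- **The type vectors of a nondegenerate family of CM types of ONE CM field are linearly independent** (any CM field). -/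
theorem linearIndependent_antiVec_of_isNondegenerateFamily (Φ : I → CMType K)
    (hΦ : CMAlgebra.IsNondegenerateFamily (K := fun _ : I => K) Φ) :
    LinearIndependent ℚ fun i => antiVec (Φ i).1 (1 : ℂ ≃+* ℂ) := by
  classical
  rw [isNondegenerateFamily_iff_typeRank_sigmaType_eq] at hΦ
  exact linearIndependent_antiVec_one_of_typeRank_sigmaType_eq (fun i => (Φ i).1)
    (fun i => isCMTypeWith_conj (Φ i)) hΦ

/-- **For a pair-flip CM field, a family of CM types is nondegenerate ⟺ its type vectors
`u_{Φ_i} = 𝟙_{Φ_i} − 𝟙_{Φ̄_i} ∈ ℚ^{Hom(K,ℂ)}` are linearly independent** (`Hg(∏_i A_{Φ_i}) = ∏_i Hg(A_{Φ_i})`, i.e.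
`B• = D•` on every product of the `A_{Φ_i}`, iff …). -/
theorem isNondegenerateFamily_iff_linearIndependent_of_pairFlip
    (hflip : ∀ s : K →+* ℂ, ∃ σ : ℂ ≃+* ℂ, σ • s = (starRingAut : ℂ ≃+* ℂ) • s ∧
      ∀ t : K →+* ℂ, t ≠ s → t ≠ (starRingAut : ℂ ≃+* ℂ) • s → σ • t = t)
    (Φ : I → CMType K) :
    CMAlgebra.IsNondegenerateFamily (K := fun _ : I => K) Φ ↔
      LinearIndependent ℚ fun i => antiVec (Φ i).1 (1 : ℂ ≃+* ℂ) := by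
  rw [isNondegenerateFamily_iff_typeRank_sigmaType_eq]
  exact typeRank_sigmaType_eq_iff_linearIndependent_of_multiplicityOne (fun i => (Φ i).1)
    (fun i => isCMTypeWith_conj (Φ i)) (exists_smul_sub_of_pairFlip hflip)

end Families

end Summit.HodgeConjecture.CorCM.GenericCMField
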